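import Summits.PneNP.PneNP.Theorems.ReslinSizeFromWidthQuadraticInduction
import Summits.PneNP.PneNP.Theorems.ReslinSizeFromWidthQuadraticDictionary

/-!
# PneNP / ReslinSizeFromWidth — the TREE-LIKE size–width law for Res(⊕), part 1: semantic core
(supports crux `ResLinSizeFromWidth`, stmt-PneNP-18932)

Route `PneNP/ReslinSizeFromWidth`.  The crux X1 = `ResLinSizeFromWidth` asks, for dag-like Res(⊕)
(Itsykson–Sokolov's system with SEMANTIC weakening), that rank-width `≥ N/m` force more than `N^C`
lines for every `C`.  Its TREE-LIKE truncation is a theorem, proved here in the tree's vocabulary: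

* `ResLinSW.exists_isRef_of_treeLike_aux` (semantic core): along a TREE-LIKE Res(⊕) derivation `π`
  (every line used as a premise at most once — the verbatim analogue for `ResLinLine` of
  `Literature.Computability.MetaComplexity.IsTreeLike`), for every line `k` and every nonempty
  ambient flat `A` inside the falsifying flat of line `k`, there is a semantic refutation inside `A`
  (`ResLinSW.IsRef`, the framework of the quadratic law) of width `≤ t + ⌊log₂ |ancestors k|⌋`.
  Induction on the size of the sub-derivation: at a resolution step on `f` the two premise
  sub-derivations are disjoint (tree-likeness), the smaller one has at most half the lines, and the
  restriction lemma for width (`ResLinSW.glue`) recombines the two halves `A ∩ {f = 0}`,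
  `A ∩ {f = 1}` paying `+1` only on the smaller side — Ben-Sasson–Wigderson's Theorem 3.3 one
  proof system up.
* `ResLinSW.exists_refutation_of_treeLike`: a tree-like Res(⊕) refutation `π` of a width-`≤ t` CNF
  yields a Res(⊕) refutation of rank-width `≤ t + 1 + ⌊log₂ |π|⌋`.
* `ResLinSW.pow_le_length_of_treeLike` (**tree-like size–width law**): if every Res(⊕) refutation
  of `φ` (clause width `≤ t`) has rank-width `≥ k`, every TREE-LIKE Res(⊕) refutation of `φ` has at
  least `2^(k - t - 1)` lines.
* Corollaries: `resLinSizeFromWidth_treeLike` — X1 HOLDS FOR TREE-LIKE REFUTATIONS (every exponent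
  `C`); `randomThreeCnf_treeLike_resLinSize_exp` — for `c ≥ 6` there is `δ > 0` with
  `Pr_{F₃(n,cn)}[unsat ∧ every tree-like Res(⊕) refutation has ≥ 2^(δ n) lines] → 1`.

In print (this is a REPRODUCTION, kernel-checked): the tree-like size–width relation for tree-like
R(lin) with semantic weakening over any field, for principal width, and over finite fields for
width (Part–Tzameret, Comput. Complexity 2021 = arXiv:1806.09383, Thm "Size-width relation" p. 7;
Garlík–Kołodziejczyk 2018 for tree-like PK_{O(1)}^{id}(⊕); Khaniki ECCC TR20-034 Thm 3.5(2) for the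
syntactic-weakening system); rank ≤ width, so the RANK form here follows from the width form.
Tree-like Res(⊕) lower bounds for random k-CNF are likewise in print (Part–Tzameret Cor. p. 7;
Itsykson–Sokolov 2020 via Prover–Delayer games). New in tree only: the statement for the tree's
`IsResLinRefutation` (semantic weakening) with `resLinWidth` (rank), machine-checked.
[BenSassonWigderson2001, Thm 3.3; ItsyksonSokolov2020, §3; PartTzameret2018, Thm size–width]
-/

namespace Summit.PneNP.PneNP.Theorems

-- `Summit.PneNP.PneNP` repeats a path component by design (summit = sub-problem); silence the linter.
set_option linter.dupNamespace false

namespace ResLinSW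

open Module Submodule Finset
open Literature.Computability.Complexity Literature.Computability.MetaComplexity

/-! ### Premise edges and ancestor sets (analogue of `Literature/…/ResolutionTreeLikeSizeWidth.lean`) -/

section Ancestors

variable {π : List ResLinLine}

/-- `LConsumes π a b`: line `b` of the Res(⊕) derivation `π` uses line `a` as a premise. -/
def LConsumes (π : List ResLinLine) (a b : ℕ) : Prop :=
  ∃ hb : b < π.length, a ∈ (π[b]'hb).premises

/-- In a Res(⊕) derivation, premises come earlier. -/
theorem LConsumes.lt {φ : CNF ℕ} (hπ : IsResLinDerivation φ π) {a b : ℕ}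
    (h : LConsumes π a b) : a < b := by
  obtain ⟨hb, ha⟩ := h
  have hv := hπ b hb
  have hlen : (π.take b).length = b := by simp [hb.le]
  unfold IsValidResLinLine at hv
  rcases hrule : (π[b]'hb).rule with _ | ⟨i, j, f⟩ | ⟨i⟩
  · simp [ResLinLine.premises, hrule, ResLinRule.premises] at ha
  · rw [hrule] at hv
    obtain ⟨hi, hj, -⟩ := hv
    rw [hlen] at hi hj
    simp only [ResLinLine.premises, hrule, ResLinRule.premises, List.mem_cons, List.not_mem_nil,
      or_false] at ha
    rcases ha with rfl | rfl <;> assumption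
  · rw [hrule] at hv
    obtain ⟨hi, -⟩ := hv
    rw [hlen] at hi
    simp only [ResLinLine.premises, hrule, ResLinRule.premises, List.mem_cons, List.not_mem_nil,
      or_false] at ha
    subst ha
    exact hi

/-- A line reachable from `a` along premise edges comes no earlier than `a`. -/
theorem le_of_reflTransGen_lConsumes {φ : CNF ℕ} (hπ : IsResLinDerivation φ π) {a b : ℕ}
    (h : Relation.ReflTransGen (LConsumes π) a b) : a ≤ b := by
  induction h with
  | refl => exact le_rfl
  | tail _ hbc ih => exact ih.trans (hbc.lt hπ).le

/-- Tree-likeness (every line is used as a premise at most once, counted with multiplicity — the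
`ResLinLine` analogue of `IsTreeLike`) makes the premise relation right-unique. -/
theorem lConsumes_rightUnique (htree : ∀ i : ℕ, (π.map fun l => l.premises.count i).sum ≤ 1) :
    Relator.RightUnique (LConsumes π) := by
  intro c p p' hp hp'
  obtain ⟨hp, hc⟩ := hp
  obtain ⟨hp', hc'⟩ := hp'
  by_contra hne
  have key : ∀ {a b : ℕ} (ha : a < π.length) (hb : b < π.length), a < b →
      c ∈ (π[a]'ha).premises → c ∈ (π[b]'hb).premises → False := by
    intro a b ha hb hab hca hcb
    have hsum := htree c
    have hsplit : (π.map fun l => l.premises.count c).sum =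
        ((π.take b).map fun l => l.premises.count c).sum +
          ((π.drop b).map fun l => l.premises.count c).sum := by
      rw [← List.sum_append, ← List.map_append, List.take_append_drop]
    have h1 : 1 ≤ ((π.take b).map fun l => l.premises.count c).sum := by
      have hmem : (π[a]'ha).premises.count c ∈ (π.take b).map fun l => l.premises.count c :=
        List.mem_map.2 ⟨π[a]'ha, List.mem_take_iff_getElem.2 ⟨a, by simp [hab, ha], by simp⟩, rfl⟩
      exact le_trans (List.count_pos_iff.2 hca) (List.le_sum_of_mem hmem)
    have h2 : 1 ≤ ((π.drop b).map fun l => l.premises.count c).sum := by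
      have hmem : (π[b]'hb).premises.count c ∈ (π.drop b).map fun l => l.premises.count c := by
        refine List.mem_map.2 ⟨π[b]'hb, ?_, rfl⟩
        rw [List.mem_iff_getElem]
        exact ⟨0, by simp; omega, by simp⟩
      exact le_trans (List.count_pos_iff.2 hcb) (List.le_sum_of_mem hmem)
    omega
  rcases lt_or_gt_of_ne hne with h | h
  · exact key hp hp' h hc hc'
  · exact key hp' hp h hc' hc

/-- In a tree-like derivation the two premises of a resolution step are different lines. -/
theorem ne_of_treeLike_resolve (htree : ∀ i : ℕ, (π.map fun l => l.premises.count i).sum ≤ 1)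
    {p i j : ℕ} {f : Finset ℕ} (hp : p < π.length) (hrule : (π[p]'hp).rule = .resolve i j f) :
    i ≠ j := by
  intro hij
  subst hij
  have hsum := htree i
  have hmem : (π[p]'hp).premises.count i ∈ π.map fun l => l.premises.count i :=
    List.mem_map.2 ⟨π[p]'hp, List.getElem_mem hp, rfl⟩
  have h2 : (π[p]'hp).premises.count i = 2 := by
    simp [ResLinLine.premises, hrule, ResLinRule.premises]
  have := List.le_sum_of_mem hmem
  omega

/-- The ANCESTOR SET of line `k`: the lines `a ≤ k` from which `k` is reachable along premise edges
(including `k`) — the sub-derivation ending in line `k`. -/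
noncomputable def lAncestors (π : List ResLinLine) (k : ℕ) : Finset ℕ := by
  classical exact (Finset.range (k + 1)).filter fun a => Relation.ReflTransGen (LConsumes π) a k

/-- Membership in the ancestor set. -/
theorem mem_lAncestors_iff {φ : CNF ℕ} (hπ : IsResLinDerivation φ π) {a k : ℕ} :
    a ∈ lAncestors π k ↔ Relation.ReflTransGen (LConsumes π) a k := by
  classical
  unfold lAncestors
  rw [Finset.mem_filter, Finset.mem_range, and_iff_right_iff_imp]
  intro h
  exact Nat.lt_succ_of_le (le_of_reflTransGen_lConsumes hπ h)

/-- A line is its own ancestor. -/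
theorem self_mem_lAncestors (k : ℕ) : k ∈ lAncestors π k := by
  classical
  exact Finset.mem_filter.2 ⟨Finset.mem_range.2 (Nat.lt_succ_self k), Relation.ReflTransGen.refl⟩

/-- The ancestor set of line `k` has at most `k + 1` elements. -/
theorem card_lAncestors_le (k : ℕ) : (lAncestors π k).card ≤ k + 1 := by
  classical
  unfold lAncestors
  exact (Finset.card_filter_le _ _).trans (by simp)

/-- Ancestors of a premise are ancestors of the conclusion. -/
theorem lAncestors_subset_of_lConsumes {φ : CNF ℕ} (hπ : IsResLinDerivation φ π) {a k : ℕ}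
    (h : LConsumes π a k) : lAncestors π a ⊆ lAncestors π k := by
  intro x hx
  rw [mem_lAncestors_iff hπ] at hx ⊢
  exact hx.tail h

/-- A line is not an ancestor of its premises. -/
theorem notMem_lAncestors_of_lConsumes {φ : CNF ℕ} (hπ : IsResLinDerivation φ π) {a k : ℕ}
    (h : LConsumes π a k) : k ∉ lAncestors π a := by
  intro hk
  rw [mem_lAncestors_iff hπ] at hk
  have h1 := le_of_reflTransGen_lConsumes hπ hk
  have h2 := h.lt hπ
  omega

/-- In a tree-like derivation the sub-derivations of two premises of one line are disjoint. -/
theorem disjoint_lAncestors {φ : CNF ℕ} (hπ : IsResLinDerivation φ π)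
    (htree : ∀ i : ℕ, (π.map fun l => l.premises.count i).sum ≤ 1) {i j k : ℕ}
    (hi : LConsumes π i k) (hj : LConsumes π j k) (hij : i ≠ j) :
    Disjoint (lAncestors π i) (lAncestors π j) := by
  rw [Finset.disjoint_left]
  intro x hxi hxj
  rw [mem_lAncestors_iff hπ] at hxi hxj
  have hU := lConsumes_rightUnique htree
  have key : ∀ {i j : ℕ}, LConsumes π i k → LConsumes π j k → i ≠ j →
      ¬ Relation.ReflTransGen (LConsumes π) i j := by
    intro i j hi hj hij hij'
    rcases hij'.cases_head with h | ⟨c, hic, hcj⟩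
    · exact hij h
    · have hck : c = k := hU hic hi
      subst hck
      have h1 := le_of_reflTransGen_lConsumes hπ hcj
      have h2 := hj.lt hπ
      omega
  rcases Relation.ReflTransGen.total_of_right_unique hU hxi hxj with h | h
  · exact key hi hj hij h
  · exact key hj hi hij.symm h

/-- Sizes of sub-derivations add up: `|ancestors i| + |ancestors j| < |ancestors k|` for a line `k`
with two distinct premises `i, j` of a tree-like derivation. -/
theorem card_lAncestors_add_lt {φ : CNF ℕ} (hπ : IsResLinDerivation φ π)
    (htree : ∀ i : ℕ, (π.map fun l => l.premises.count i).sum ≤ 1) {i j k : ℕ}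
    (hi : LConsumes π i k) (hj : LConsumes π j k) (hij : i ≠ j) :
    (lAncestors π i).card + (lAncestors π j).card < (lAncestors π k).card := by
  classical
  have hdisj := disjoint_lAncestors hπ htree hi hj hij
  have hsub : lAncestors π i ∪ lAncestors π j ⊆ (lAncestors π k).erase k := by
    intro x hx
    rw [Finset.mem_erase]
    rcases Finset.mem_union.1 hx with h | h
    · exact ⟨fun hxk => notMem_lAncestors_of_lConsumes hπ hi (hxk ▸ h),
        lAncestors_subset_of_lConsumes hπ hi h⟩
    · exact ⟨fun hxk => notMem_lAncestors_of_lConsumes hπ hj (hxk ▸ h),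
        lAncestors_subset_of_lConsumes hπ hj h⟩
  have h1 := Finset.card_le_card hsub
  rw [Finset.card_union_of_disjoint hdisj,
    Finset.card_erase_of_mem (self_mem_lAncestors k)] at h1
  have h2 : 0 < (lAncestors π k).card := Finset.card_pos.2 ⟨k, self_mem_lAncestors k⟩
  omega

/-- The sub-derivation of a (single) premise is smaller. -/
theorem card_lAncestors_lt_of_lConsumes {φ : CNF ℕ} (hπ : IsResLinDerivation φ π) {a k : ℕ}
    (h : LConsumes π a k) : (lAncestors π a).card < (lAncestors π k).card := by
  classical
  refine Finset.card_lt_card ⟨lAncestors_subset_of_lConsumes hπ h, fun hsub => ?_⟩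
  exact notMem_lAncestors_of_lConsumes hπ h (hsub (self_mem_lAncestors k))

end Ancestors

/-! ### The semantic core: a tree-like derivation gives narrow semantic refutations -/

section TreeLike

open Literature.Computability.MetaComplexity.AffSys
open Summit.PneNP.PneNP.Theorems.ResLinRank

variable (N : Finset ℕ)

/-- The one-line refutation `[A]` of an ambient flat lying inside an axiom flat has width `0`. -/
theorem isRef_singleton {𝒞 : Set (Set (↥N → ZMod 2))} {A F : Set (↥N → ZMod 2)} (hF : F ∈ 𝒞)
    (hAF : A ⊆ F) (hA : IsFlat A) : IsRef 𝒞 A [A] ∧ width A [A] = 0 := by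
  refine ⟨⟨⟨Justified.ax F hF hAF, trivial⟩, List.mem_singleton_self _, ?_, ?_⟩, ?_⟩
  · intro M hM
    rw [List.mem_singleton] at hM
    rw [hM]
  · intro M hM
    rw [List.mem_singleton] at hM
    rw [hM]; exact hA
  · apply Nat.le_zero.1
    rw [width_le_iff]
    intro M hM _
    rw [List.mem_singleton] at hM
    rw [hM, codim, Nat.sub_self]

/-- **Semantic core of the tree-like law.** Let `π` be a TREE-LIKE Res(⊕) derivation from the
width-`≤ t` CNF `φ` (forms inside the window `N`).  For every line `k` whose sub-derivation has at
most `S` lines and every nonempty flat `A` inside the falsifying flat of line `k` on which the axiom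
flats have relative rank `≤ t`, there is a semantic refutation of the axiom flats of `φ` inside `A`
of width `≤ t + ⌊log₂ S⌋`.  (BSW Thm 3.3 one system up: at a resolution step the smaller premise
sub-derivation has `≤ S/2` lines; recombine by the restriction lemma for width `glue`, paying `+1`
on the smaller side only.) -/
theorem exists_isRef_of_treeLike_aux {φ : CNF ℕ} {t : ℕ} {π : List ResLinLine}
    (hder : IsResLinDerivation φ π)
    (htree : ∀ i : ℕ, (π.map fun l => l.premises.count i).sum ≤ 1)
    (hNπ : ∀ l ∈ π, ∀ lit ∈ l.clause, lit.1 ⊆ N) :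
    ∀ (S k : ℕ) (hk : k < π.length), (lAncestors π k).card ≤ S →
      ∀ A : Set (↥N → ZMod 2), IsFlat A → A.Nonempty → A ⊆ falsN N (π[k]'hk).clause →
        GoodAxioms (axiomFlats N φ) A t →
        ∃ R, IsRef (axiomFlats N φ) A R ∧ width A R ≤ t + Nat.log 2 S := by
  classical
  intro S
  induction S using Nat.strong_induction_on with
  | _ S IH =>
  intro k hk hS A hA hAne hAk hg
  have hv := hder k hk
  have hlen : (π.take k).length = k := by simp [hk.le]
  unfold IsValidResLinLine at hv
  rcases hrule : (π[k]'hk).rule with _ | ⟨i, j, f⟩ | ⟨i⟩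
  · -- an initial clause: `A` lies inside an axiom flat; the one-line refutation `[A]`
    rw [hrule] at hv
    obtain ⟨c, hc, hcl⟩ := hv
    have hF : falsN N (π[k]'hk).clause ∈ axiomFlats N φ := ⟨c, hc, by rw [hcl]⟩
    obtain ⟨hR, hw⟩ := isRef_singleton N hF hAk hA
    exact ⟨[A], hR, by rw [hw]; exact Nat.zero_le _⟩
  · -- a resolution step on `f` from lines `i` (containing `f = 0`) and `j` (containing `f = 1`)
    rw [hrule] at hv
    obtain ⟨hi, hj, C, D, hCi, hDj, hcl⟩ := hv
    rw [hlen] at hi hj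
    have hik : i < π.length := hi.trans hk
    have hjk : j < π.length := hj.trans hk
    have hgi : (π.take k)[i]'(by rw [hlen]; exact hi) = π[i]'hik := List.getElem_take
    have hgj : (π.take k)[j]'(by rw [hlen]; exact hj) = π[j]'hjk := List.getElem_take
    rw [hgi] at hCi
    rw [hgj] at hDj
    have hci : LConsumes π i k := ⟨hk, by simp [ResLinLine.premises, hrule, ResLinRule.premises]⟩
    have hcj : LConsumes π j k := ⟨hk, by simp [ResLinLine.premises, hrule, ResLinRule.premises]⟩
    have hij : i ≠ j := ne_of_treeLike_resolve htree hk hrule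
    have hadd := card_lAncestors_add_lt hder htree hci hcj hij
    have hSi : (lAncestors π i).card < S := by omega
    have hSj : (lAncestors π j).card < S := by omega
    -- the two halves of `A` along `θ = (f = 1)`-is-false, i.e. `⟨f, z⟩ = 1`
    set θ : Eqn ↥N := eqOf N (f, false) with hθ
    have h0sub : A ∩ hyp θ ⊆ falsN N (π[i]'hik).clause := by
      intro z hz
      have hz' : z ∈ falsN N (π[k]'hk).clause := hAk hz.1
      rw [hcl, falsN_union] at hz'
      rw [hCi, falsN_insert]
      exact ⟨hz.2, hz'.1⟩
    have h1sub : A ∩ hyp (θ + one) ⊆ falsN N (π[j]'hjk).clause := by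
      intro z hz
      have hz' : z ∈ falsN N (π[k]'hk).clause := hAk hz.1
      rw [hcl, falsN_union] at hz'
      rw [hDj, falsN_insert, eqOf_true_eq]
      exact ⟨hz.2, hz'.2⟩
    by_cases h1ne : (A ∩ hyp (θ + one)).Nonempty
    · by_cases h0ne : (A ∩ hyp θ).Nonempty
      · -- both halves nonempty: recurse on both and glue
        have hH0 : IsFlat (A ∩ hyp θ) := hA.inter (isFlat_hyp θ)
        have hH1 : IsFlat (A ∩ hyp (θ + one)) := hA.inter (isFlat_hyp _)
        have hg0 : GoodAxioms (axiomFlats N φ) (A ∩ hyp θ) t := hg.section hA h0ne h1ne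
        have hg1 : GoodAxioms (axiomFlats N φ) (A ∩ hyp (θ + one)) t := by
          refine hg.section hA h1ne ?_
          rw [add_one_add_one]; exact h0ne
        obtain ⟨R0, hR0, hw0⟩ := IH _ hSi i hik le_rfl (A ∩ hyp θ) hH0 h0ne h0sub hg0
        obtain ⟨R1, hR1, hw1⟩ := IH _ hSj j hjk le_rfl (A ∩ hyp (θ + one)) hH1 h1ne h1sub hg1
        have hS2 : 2 ≤ S := by
          have h1 : 0 < (lAncestors π i).card := Finset.card_pos.2 ⟨i, self_mem_lAncestors i⟩
          have h2 : 0 < (lAncestors π j).card := Finset.card_pos.2 ⟨j, self_mem_lAncestors j⟩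
          omega
        have hlogS : 1 ≤ Nat.log 2 S := by
          rw [Nat.succ_le_iff, Nat.log_pos_iff]
          omega
        rcases le_or_gt (lAncestors π j).card (lAncestors π i).card with hle | hlt
        · -- the `j`-side (inside `hyp (θ+1)`) is the smaller one: it pays the `+1`
          have hhalf : (lAncestors π j).card ≤ S / 2 := by omega
          have hlogj : Nat.log 2 (lAncestors π j).card ≤ Nat.log 2 S - 1 := by
            have := Nat.log_mono_right (b := 2) hhalf
            rwa [Nat.log_div_base] at this
          have hlogi : Nat.log 2 (lAncestors π i).card ≤ Nat.log 2 S :=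
            Nat.log_mono_right hSi.le
          obtain ⟨G, hG, hwG⟩ := glue hg hA θ h0ne h1ne hR1 hR0
          refine ⟨G, hG, hwG.trans ?_⟩
          rw [max_le_iff, max_le_iff]
          exact ⟨by omega, by omega, by omega⟩
        · -- the `i`-side (inside `hyp θ`) is the smaller one: glue along `θ + 1`
          have hhalf : (lAncestors π i).card ≤ S / 2 := by omega
          have hlogi : Nat.log 2 (lAncestors π i).card ≤ Nat.log 2 S - 1 := by
            have := Nat.log_mono_right (b := 2) hhalf
            rwa [Nat.log_div_base] at this
          have hlogj : Nat.log 2 (lAncestors π j).card ≤ Nat.log 2 S :=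
            Nat.log_mono_right hSj.le
          have h0ne' : (A ∩ hyp (θ + one + one)).Nonempty := by
            rw [add_one_add_one]; exact h0ne
          have hR0' : IsRef (axiomFlats N φ) (A ∩ hyp (θ + one + one)) R0 := by
            rw [add_one_add_one]; exact hR0
          obtain ⟨G, hG, hwG⟩ := glue hg hA (θ + one) h1ne h0ne' hR0' hR1
          refine ⟨G, hG, hwG.trans ?_⟩
          rw [add_one_add_one] at hwG ⊢
          rw [max_le_iff, max_le_iff]
          exact ⟨by omega, by omega, by omega⟩
      · -- `A ∩ hyp θ = ∅`: `A` lies in the `j`-premise's flat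
        have hAj : A ⊆ falsN N (π[j]'hjk).clause := by
          intro z hz
          have hzθ : z ∉ hyp θ := fun h => h0ne ⟨z, hz, h⟩
          exact h1sub ⟨hz, mem_hyp_add_one_iff.2 hzθ⟩
        obtain ⟨R, hR, hw⟩ := IH _ hSj j hjk le_rfl A hA hAne hAj hg
        exact ⟨R, hR, hw.trans (by have := Nat.log_mono_right (b := 2) hSj.le; omega)⟩
    · -- `A ∩ hyp (θ+1) = ∅`: `A` lies in the `i`-premise's flat
      have hAi : A ⊆ falsN N (π[i]'hik).clause := by
        intro z hz
        have hzθ : z ∈ hyp θ := by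
          by_contra h
          exact h1ne ⟨z, hz, mem_hyp_add_one_iff.2 h⟩
        exact h0sub ⟨hz, hzθ⟩
      obtain ⟨R, hR, hw⟩ := IH _ hSi i hik le_rfl A hA hAne hAi hg
      exact ⟨R, hR, hw.trans (by have := Nat.log_mono_right (b := 2) hSi.le; omega)⟩
  · -- a semantic weakening of line `i`: `fals (line k) ⊆ fals (line i)`
    rw [hrule] at hv
    obtain ⟨hi, himp⟩ := hv
    rw [hlen] at hi
    have hik : i < π.length := hi.trans hk
    have hgi : (π.take k)[i]'(by rw [hlen]; exact hi) = π[i]'hik := List.getElem_take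
    rw [hgi] at himp
    have hci : LConsumes π i k := ⟨hk, by simp [ResLinLine.premises, hrule, ResLinRule.premises]⟩
    have hSi : (lAncestors π i).card < S :=
      lt_of_lt_of_le (card_lAncestors_lt_of_lConsumes hder hci) hS
    have hsub : falsN N (π[k]'hk).clause ⊆ falsN N (π[i]'hik).clause :=
      falsN_subset_of_imp N (hNπ _ (List.getElem_mem hik)) (hNπ _ (List.getElem_mem hk)) himp
    obtain ⟨R, hR, hw⟩ := IH _ hSi i hik le_rfl A hA hAne (hAk.trans hsub) hg
    exact ⟨R, hR, hw.trans (by have := Nat.log_mono_right (b := 2) hSi.le; omega)⟩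

end TreeLike

end ResLinSW

end Summit.PneNP.PneNP.Theorems
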